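import Summits.BirchSwinnertonDyer.BirchSwinnertonDyer.Theorems.RamifiedHeegnerPairWAllExclAddGssAtThreeColumnAssemblyTwistUnits
import Summits.BirchSwinnertonDyer.BirchSwinnertonDyer.Theorems.RamifiedHeegnerPairLeafRankZeroUpperAtThreeTwistUnitNonsplit
import Summits.BirchSwinnertonDyer.BirchSwinnertonDyer.Theorems.RamifiedHeegnerPairLeafRankZeroUpperAtThreeOfNonSurjThree
import HarnessLib

/-!
# Route `RamifiedHeegnerPair` (leaf `WAllExclAddGssAtThree`, W-ALL row 2·3@3) — the COLUMN ASSEMBLY v4: the rank-zero twist-unit input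
# RESTRICTED to the `3Nn` rows (TU₀|3Nn, rhp-p2 g7 p633230) — and the L₁ line `kolyvagin_split` with its fifth stub paid by TU₀|3Nn

HONEST FRAMING. Theorems only; helper file (`--supports stmt-BirchSwinnertonDyer-26021 --as helper`); nothing is booked, no item is closed,
no skeleton is re-registered (the line of record of L₁ 26021 stays v5 = 1b457893ad53e5c0 with the fifth stub U₀|3Nn; pen state B0), and BSD is
not proved for any curve. EVERY research hypothesis below is OPEN: A 27200 / A₃ₙₙ / A₀ (T1⁻: ONE derived-Heegner-point certificate of adjusted
BSD depth per frame at an additive `3` — no engine in print: W. Zhang 2014 Thm. 1.1 and Sweeting 2020 Thm. 1.1/1.3 need `p ≥ 5`, `p ∤ N`),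
S2 27492 / Σ★″ 27493 (T1⁺ readings of Jetchev 2008 at `p ∣ N`), TU₀|3Nn / TU₁ (arithmetic-statistics ∃-statements with SURPLUS over the leaf —
«some odd Heegner field whose complementary-rank twist has 3-unit #Ш_an» — not in print at an additive `3`); PUB 27199 / PUB⁺ 27491 / PUB₀⁺ and
the Matar–Nekovář fact are un-discharged print. Lead prover bsd-line-rhp-p1 g7, 2026-08-28 (the integration asked by rhp-p2 g7, STATUS
2026-08-28T12:25:27Z). Sequel of v1 (p631681: S₊ := U₀|3Nn, S₋ := L₀), v2 (p632422: S₋ := TU₁) and v3 (p633075: S₊ := TU₀ on ALL rank-zero rows).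

WHAT v4 CHANGES vs v3. v3 asked TU₀ at EVERY non-CM rank-zero leaf curve. But U₀ is Kato-print on the tower rows (`ρ̄_{E,3}` onto ⟹ full 3-adic
tower on the (G) cell, `RamifiedPairLowerBound.towerSurj_three_of_subGss_of_surj`; Kato 2004 Thm. 14.5 (3) + Prop. 14.16 (2) = the last conjunct
of PUB 27199), so the twist-unit statement is needed ONLY on the `3Nn` rank-zero rows (`ρ̄_{E,3}` NOT onto; image `C_ns⁺(3)`; 53 classes of the
census `N < 5·10⁵`, inside `EulerSystemBigImageBarrier`): rhp-p2 g7's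
`RamifiedPairUpperBound.leafRankZeroUpper_nonsplitRows_of_pubManin_of_divisibilityReading_of_sigmaStar_of_twistUnitZeroNonsplit` (p633230) gives
U₀|3Nn — the text of the v5 stub `stub_leafRankZeroUpper_nonsplitRows` VERBATIM — from PUB₀⁺ ∧ S2 ∧ Σ★″ ∧ TU₀|3Nn.

* §1 `gss2LowerAtThreeRankOne_of_pub_of_pairStatements_of_twistUnitZeroNonsplit` — **L₁ 26021 BY NAME ⟸ PUB ∧ PUB₀⁺ ∧ STRUCT ∧ A ∧ A₃ₙₙ ∧ S2 ∧
  Σ★″ ∧ TU₀|3Nn**: the v5 composition (p631681 §1) with its fifth hypothesis discharged by p633230. This is the composition a skeleton v6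
  «fifth stub := TU₀|3Nn» would register (pre-staged for a B1 ruling; NOT registered here).
* §2 `leafRankZeroUpperAtThree_of_katoTam_of_pairStatements_of_twistUnitZeroNonsplit` — **U₀ 26024 BY NAME ⟸ Kato A161″ ∧ GZK ∧ modularity ∧
  PUB₀⁺ ∧ S2 ∧ Σ★″ ∧ TU₀|3Nn** (p630156 ∘ p633230): the member U₀ costs the twist-unit statement on its `3Nn` rows only.
* §3 `wAllExclAddGssAtThree_of_print_of_pairStatements_of_twistUnitsNonsplit` — **the column: leaf ⟸ GZK ∧ PUB ∧ PUB⁺ ∧ PUB₀⁺ ∧ MN ∧ A ∧ A₃ₙₙ ∧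
  A₀ ∧ S2 ∧ Σ★″ ∧ TU₀|3Nn ∧ TU₁** — every input Kolyvagin-native plus two twist-unit ∃-statements, the rank-zero one on the `3Nn` rows only;
  U₀, U₁, L₀, L₁ all DERIVED (U₁ ⟸ PUB⁺ ∧ S2 ∧ Σ★″ ∧ TU₁, p630223; L₀ ⟸ PUB ∧ STRUCT ∧ A₀ ∧ U₁, p631233 §3). The proof graph is acyclic.

Residual list of the column read off §3 (honest; memo COUPLING-CALCULUS-rhp-p1-g6 v2 §6 with TU₀ ↦ TU₀|3Nn):
T1⁻ (A 27200 ⊔ A₃ₙₙ ⊔ A₀) ⊔ T1⁺ (S2, Σ★″) ⊔ TU₀|3Nn ⊔ TU₁, all OPEN; print un-discharged.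

References: [cite: MatarNekovar2019, Thm. 0.7 (p. 456) and §0.11 (p. 457)] [cite: McCallumLMS1991, §5 Cor. 5.6 (p. 310)]
[cite: Kato2004Asterisque, Thm. 14.5 (3) (p. 236), Prop. 14.16 (2) (p. 244), (12.5.2) (p. 222)] [cite: Jetchev2008, Thm. 1.4, Conj. 1.3]
[cite: WZhang2014, Thm. 1.1 (p. 195)] [cite: OnoSkinner1998, Thm. 1] [cite: Miller2011LMS, Def. 1.1] [cite: Serre1972, §2.4 Prop. 15].
-/

-- D-0017: single-problem summit, so `Summit.BirchSwinnertonDyer.BirchSwinnertonDyer.…` repeats a namespace BY DESIGN.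
set_option linter.dupNamespace false
set_option autoImplicit false

noncomputable section

open scoped Classical NumberField

open WeierstrassCurve Literature.NumberTheory.EllipticCurves
  Literature.NumberTheory.EllipticCurves.Rank1Residual
  Literature.NumberTheory.EllipticCurves.Rank1Residual.Typed
  Summit.BirchSwinnertonDyer.Rank1Residual
  Summit.BirchSwinnertonDyer.Rank1Residual.Additive
  Summit.BirchSwinnertonDyer.BirchSwinnertonDyer.Theorems
  Summit.BirchSwinnertonDyer.BirchSwinnertonDyer.Theses.RamifiedHeegnerPair

namespace Summit.BirchSwinnertonDyer.BirchSwinnertonDyer.Theorems.RamifiedPairLowerBound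

/-! ## §1 The L₁ line with its fifth stub paid by TU₀|3Nn -/

/-- **L₁ 26021 `Gss2LowerAtThreeRankOne` BY NAME ⟸ PUB 27199 ∧ PUB₀⁺ ∧ STRUCT ∧ A 27200 ∧ A₃ₙₙ ∧ S2 27492 ∧ Σ★″ 27493 ∧ TU₀|3Nn.** The v5
composition `gss2LowerAtThreeRankOne_of_pub_of_certificatesTower_of_structIrr_of_certificates3Nn_of_upper3Nn` (p631681 §1: split on `ρ̄_{E,3}`
onto; tower ⟹ McCallum road with A and Kato for the twist; `3Nn` ⟹ A₃ₙₙ's odd frame, the twist is a `3Nn` rank-zero leaf curve, U₀|3Nn gives its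
upper half, the irreducible road gives L₁) with the fifth hypothesis U₀|3Nn DISCHARGED by rhp-p2 g7's
`leafRankZeroUpper_nonsplitRows_of_pubManin_of_divisibilityReading_of_sigmaStar_of_twistUnitZeroNonsplit` (p633230) from PUB₀⁺ (rhp-p2's
rank-zero print conjunction, verbatim), S2, Σ★″ and the twist-unit datum TU₀|3Nn (asked only at non-CM rank-zero leaf curves with `ρ̄_{W,3}` NOT
onto). Conditional on every displayed input; books nothing; the registered skeleton of 26021 stays v5. [cite: MatarNekovar2019, Thm. 0.7 (p. 456) and §0.11 (p. 457)]
[cite: McCallumLMS1991, §5 Cor. 5.6 (p. 310)] [cite: Kato2004Asterisque, Thm. 14.5 (3) (p. 236)] [cite: Jetchev2008, Thm. 1.4] -/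
theorem gss2LowerAtThreeRankOne_of_pub_of_pairStatements_of_twistUnitZeroNonsplit
    (hpub : Gss2LowerPrintedInputsAtThree)
    (hpub0 : (∀ (N : ℕ) [NeZero N] (W : WeierstrassCurve ℚ) (K : Type) [Field K] [NumberField K],
        Literature.NumberTheory.EllipticCurves.gross_zagier N W K) ∧
      (∀ (N : ℕ) [NeZero N] (W : WeierstrassCurve ℚ) (K : Type) [Field K] [NumberField K],
        Literature.NumberTheory.EllipticCurves.kolyvagin N W K) ∧
      Literature.NumberTheory.EllipticCurves.rank_eq_analyticRank_of_analyticRank_le_one ∧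
      WeierstrassCurve.hasEntireLFunction_rat ∧
      Literature.NumberTheory.EllipticCurves.MatarNekovar2019.thm07_padicValNat_card_sha_primary_add_le_of_globalDivisibility_of_irreducible ∧
      Literature.NumberTheory.EllipticCurves.ModularForms.exists_isNewformOf ∧
      Literature.NumberTheory.EllipticCurves.bumpFriedbergHoffstein_exists_heegnerField_split_twist_simpleZero ∧
      Literature.NumberTheory.EllipticCurves.ModularForms.nonempty_modularParametrizationData ∧
      WeierstrassCurve.bsdRHS_eq_of_isIsogenous ∧
      Literature.NumberTheory.EllipticCurves.ModularForms.mazur_not_dvd_maninConstant_of_odd ∧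
      Literature.NumberTheory.EllipticCurves.ModularForms.abbesUllmo_not_dvd_maninConstant_of_not_dvd_level ∧
      Literature.NumberTheory.EllipticCurves.ModularForms.cesnavicius_not_two_dvd_maninConstant_of_two_dvd_level)
    (hMN : MatarNekovar2019.thm07_pow_dvd_card_sha_primary_of_certificate_of_irreducible)
    (hC : Gss2RankOneMcCallumCertificateAtThreeTower)
    (hC3 : ∀ (W : WeierstrassCurve ℚ) [W.IsElliptic] [W.IsGloballyMinimal], ¬ W.HasCM →
      Literature.NumberTheory.EllipticCurves.Rank1Residual.Addv W 3 → Summit.BirchSwinnertonDyer.Rank1Residual.Additive.SubGss W 3 →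
      W.analyticRank = 1 → ¬ W.HasSurjectiveModNGaloisRep 3 →
      ∃ (N : ℕ) (_ : NeZero N) (K : Type) (_ : Field K) (_ : NumberField K)
        (Dt : Literature.NumberTheory.EllipticCurves.ModularForms.ModularParametrizationData W N)
        (H : Literature.NumberTheory.EllipticCurves.HeegnerDatum N (NumberField.discr K)) (ι : K →+* ℂ)
        (P : (W.baseChange K).toAffine.Point) (Wd : WeierstrassCurve ℚ) (_ : Wd.IsElliptic) (_ : Wd.IsGloballyMinimal)
        (Cd : WeierstrassCurve.VariableChange ℚ) (M : ℕ),
        W.conductorNorm ℤ = N ∧ Literature.NumberTheory.EllipticCurves.IsImaginaryQuadratic K ∧ Odd (NumberField.discr K) ∧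
        Literature.NumberTheory.EllipticCurves.SatisfiesHeegnerHypothesis N K ∧
        (W.quadraticTwist (NumberField.discr K : ℚ)).entireLFunction 1 ≠ 0 ∧
        WeierstrassCurve.Affine.Point.map ι.toRatAlgHom P = Literature.NumberTheory.EllipticCurves.ModularForms.heegnerPointComplex Dt H ∧
        Cd • W.quadraticTwist (NumberField.discr K : ℚ) = Wd ∧
        (2 * M : ℤ) ≤ padicValNat 3 W.tamagawaProduct + padicValNat 3 Wd.tamagawaProduct + 2 * padicValRat 3 (Dt.c : ℚ) ∧
        Summit.BirchSwinnertonDyer.Rank1Residual.X11b.Three.Koly.CertificateAt Dt H.β ι 3 M)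
    (hS2 : JetchevDivisibilityReadingS2) (hSig : LeafSigmaStarDivisibilityAtThreeOptimalOffRows)
    (hTU0ns : ∀ (W : WeierstrassCurve ℚ) [W.IsElliptic] [W.IsGloballyMinimal], ¬ W.HasCM →
      Literature.NumberTheory.EllipticCurves.Rank1Residual.Addv W 3 →
      Summit.BirchSwinnertonDyer.Rank1Residual.Additive.SubGss W 3 → W.analyticRank = 0 →
      ¬ W.HasSurjectiveModNGaloisRep 3 →
      ∃ (K : Type) (_ : Field K) (_ : NumberField K) (W₂ W₂d : WeierstrassCurve ℚ) (_ : W₂.IsElliptic)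
        (_ : W₂.IsGloballyMinimal) (_ : W₂d.IsElliptic) (_ : W₂d.IsGloballyMinimal),
        IsImaginaryQuadratic K ∧ Odd (NumberField.discr K) ∧ SatisfiesHeegnerHypothesis (W.conductorNorm ℤ) K ∧
        (W.quadraticTwist (NumberField.discr K : ℚ)).entireLFunction 1 = 0 ∧
        deriv (W.quadraticTwist (NumberField.discr K : ℚ)).entireLFunction 1 ≠ 0 ∧
        IsIsogenous W W₂ ∧ (∃ C : VariableChange ℚ, C • W₂.quadraticTwist (NumberField.discr K : ℚ) = W₂d) ∧
        ∃ qd : ℚ, shaAn W₂d = (qd : ℂ) ∧ padicValRat 3 qd ≤ 0) :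
    Gss2LowerAtThreeRankOne :=
  gss2LowerAtThreeRankOne_of_pub_of_certificatesTower_of_structIrr_of_certificates3Nn_of_upper3Nn hpub hC hMN hC3
    (RamifiedPairUpperBound.leafRankZeroUpper_nonsplitRows_of_pubManin_of_divisibilityReading_of_sigmaStar_of_twistUnitZeroNonsplit
      hpub0 hS2 hSig hTU0ns)

/-! ## §2 The member U₀ with the twist-unit input on its `3Nn` rows only -/

/-- **U₀ 26024 `LeafRankZeroUpperAtThree` BY NAME ⟸ Kato A161″ ∧ GZK ∧ modularity ∧ PUB₀⁺ ∧ S2 ∧ Σ★″ ∧ TU₀|3Nn.** The tower rows are Kato-print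
(`RamifiedPairUpperBound.leafRankZeroUpperAtThree_of_katoTam_of_nonSurjThree`, p630156: `ρ̄_{E,3}` onto ⟹ tower on the (G) cell); the `3Nn`
rows are p633230. So the member costs the twist-unit ∃-statement on its 53 normaliser-image classes (census `N < 5·10⁵`) and nothing of TU₀
elsewhere. Conditional on every displayed input; books nothing. [cite: Kato2004Asterisque, Thm. 14.5 (3) (p. 236), Prop. 14.16 (2) (p. 244)]
[cite: MatarNekovar2019, Thm. 0.7 (p. 456)] [cite: Jetchev2008, Thm. 1.4] [cite: Miller2011LMS, Def. 1.1] -/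
theorem leafRankZeroUpperAtThree_of_katoTam_of_pairStatements_of_twistUnitZeroNonsplit
    (hKatoT : Kato2004.rankZero_padicValNat_sha_add_padicValNat_tamagawa_le_of_additive_potGood_of_imageContainsSL2)
    (hGZK : rank_eq_analyticRank_of_analyticRank_le_one) (hmod : hasEntireLFunction_rat)
    (hpub0 : (∀ (N : ℕ) [NeZero N] (W : WeierstrassCurve ℚ) (K : Type) [Field K] [NumberField K],
        Literature.NumberTheory.EllipticCurves.gross_zagier N W K) ∧
      (∀ (N : ℕ) [NeZero N] (W : WeierstrassCurve ℚ) (K : Type) [Field K] [NumberField K],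
        Literature.NumberTheory.EllipticCurves.kolyvagin N W K) ∧
      Literature.NumberTheory.EllipticCurves.rank_eq_analyticRank_of_analyticRank_le_one ∧
      WeierstrassCurve.hasEntireLFunction_rat ∧
      Literature.NumberTheory.EllipticCurves.MatarNekovar2019.thm07_padicValNat_card_sha_primary_add_le_of_globalDivisibility_of_irreducible ∧
      Literature.NumberTheory.EllipticCurves.ModularForms.exists_isNewformOf ∧
      Literature.NumberTheory.EllipticCurves.bumpFriedbergHoffstein_exists_heegnerField_split_twist_simpleZero ∧
      Literature.NumberTheory.EllipticCurves.ModularForms.nonempty_modularParametrizationData ∧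
      WeierstrassCurve.bsdRHS_eq_of_isIsogenous ∧
      Literature.NumberTheory.EllipticCurves.ModularForms.mazur_not_dvd_maninConstant_of_odd ∧
      Literature.NumberTheory.EllipticCurves.ModularForms.abbesUllmo_not_dvd_maninConstant_of_not_dvd_level ∧
      Literature.NumberTheory.EllipticCurves.ModularForms.cesnavicius_not_two_dvd_maninConstant_of_two_dvd_level)
    (hS2 : JetchevDivisibilityReadingS2) (hSig : LeafSigmaStarDivisibilityAtThreeOptimalOffRows)
    (hTU0ns : ∀ (W : WeierstrassCurve ℚ) [W.IsElliptic] [W.IsGloballyMinimal], ¬ W.HasCM →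
      Literature.NumberTheory.EllipticCurves.Rank1Residual.Addv W 3 →
      Summit.BirchSwinnertonDyer.Rank1Residual.Additive.SubGss W 3 → W.analyticRank = 0 →
      ¬ W.HasSurjectiveModNGaloisRep 3 →
      ∃ (K : Type) (_ : Field K) (_ : NumberField K) (W₂ W₂d : WeierstrassCurve ℚ) (_ : W₂.IsElliptic)
        (_ : W₂.IsGloballyMinimal) (_ : W₂d.IsElliptic) (_ : W₂d.IsGloballyMinimal),
        IsImaginaryQuadratic K ∧ Odd (NumberField.discr K) ∧ SatisfiesHeegnerHypothesis (W.conductorNorm ℤ) K ∧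
        (W.quadraticTwist (NumberField.discr K : ℚ)).entireLFunction 1 = 0 ∧
        deriv (W.quadraticTwist (NumberField.discr K : ℚ)).entireLFunction 1 ≠ 0 ∧
        IsIsogenous W W₂ ∧ (∃ C : VariableChange ℚ, C • W₂.quadraticTwist (NumberField.discr K : ℚ) = W₂d) ∧
        ∃ qd : ℚ, shaAn W₂d = (qd : ℂ) ∧ padicValRat 3 qd ≤ 0) :
    LeafRankZeroUpperAtThree :=
  RamifiedPairUpperBound.leafRankZeroUpperAtThree_of_katoTam_of_nonSurjThree hKatoT hGZK hmod
    (RamifiedPairUpperBound.leafRankZeroUpper_nonsplitRows_of_pubManin_of_divisibilityReading_of_sigmaStar_of_twistUnitZeroNonsplit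
      hpub0 hS2 hSig hTU0ns)

/-! ## §3 The column assembly v4 -/

/-- **THE Gss2 COLUMN MODULO THE PAIR STATEMENTS, v4 (S₊ := TU₀|3Nn, S₋ := TU₁; U₀, U₁, L₀, L₁ DERIVED).** `WAllExclAddGssAtThree` from: PRINT —
GZK, PUB 27199, PUB⁺ 27491, PUB₀⁺, the Matar–Nekovář structure fact; T1⁻ — A 27200, A₃ₙₙ, A₀; the T1⁺ readings — S2 27492, Σ★″ 27493; and the
two TWIST-UNIT statements TU₀|3Nn (rank-zero leaf, `ρ̄_{W,3}` NOT onto only) and TU₁ (rank-one leaf). Chain: §1 ⟹ L₁; §2 ⟹ U₀ (Kato on the tower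
rows); p630223 ⟹ U₁ from (PUB⁺, S2, Σ★″, TU₁); p631233 §3 ⟹ L₀ from (PUB, STRUCT, A₀, U₁); the route's `closes`. No member half, no U₀|3Nn and
no Kato-⊇ is a hypothesis; v3's TU₀ is weakened to its `3Nn` rows. Books nothing; states what the column costs. [cite: Miller2011LMS, Def. 1.1]
[cite: MatarNekovar2019, Thm. 0.7 (p. 456) and §0.11 (p. 457)] [cite: Kato2004Asterisque, Thm. 14.5 (3) (p. 236)] [cite: Jetchev2008, Thm. 1.4]
[cite: OnoSkinner1998, Thm. 1] -/
theorem wAllExclAddGssAtThree_of_print_of_pairStatements_of_twistUnitsNonsplit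
    (hP : PublishedInputGZK) (hpub : Gss2LowerPrintedInputsAtThree) (hpubU : LeafRankOnePrintedInputsAtThree)
    (hpub0 : (∀ (N : ℕ) [NeZero N] (W : WeierstrassCurve ℚ) (K : Type) [Field K] [NumberField K],
        Literature.NumberTheory.EllipticCurves.gross_zagier N W K) ∧
      (∀ (N : ℕ) [NeZero N] (W : WeierstrassCurve ℚ) (K : Type) [Field K] [NumberField K],
        Literature.NumberTheory.EllipticCurves.kolyvagin N W K) ∧
      Literature.NumberTheory.EllipticCurves.rank_eq_analyticRank_of_analyticRank_le_one ∧
      WeierstrassCurve.hasEntireLFunction_rat ∧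
      Literature.NumberTheory.EllipticCurves.MatarNekovar2019.thm07_padicValNat_card_sha_primary_add_le_of_globalDivisibility_of_irreducible ∧
      Literature.NumberTheory.EllipticCurves.ModularForms.exists_isNewformOf ∧
      Literature.NumberTheory.EllipticCurves.bumpFriedbergHoffstein_exists_heegnerField_split_twist_simpleZero ∧
      Literature.NumberTheory.EllipticCurves.ModularForms.nonempty_modularParametrizationData ∧
      WeierstrassCurve.bsdRHS_eq_of_isIsogenous ∧
      Literature.NumberTheory.EllipticCurves.ModularForms.mazur_not_dvd_maninConstant_of_odd ∧
      Literature.NumberTheory.EllipticCurves.ModularForms.abbesUllmo_not_dvd_maninConstant_of_not_dvd_level ∧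
      Literature.NumberTheory.EllipticCurves.ModularForms.cesnavicius_not_two_dvd_maninConstant_of_two_dvd_level)
    (hMN : MatarNekovar2019.thm07_pow_dvd_card_sha_primary_of_certificate_of_irreducible)
    (hC : Gss2RankOneMcCallumCertificateAtThreeTower)
    (hC3 : ∀ (W : WeierstrassCurve ℚ) [W.IsElliptic] [W.IsGloballyMinimal], ¬ W.HasCM →
      Literature.NumberTheory.EllipticCurves.Rank1Residual.Addv W 3 → Summit.BirchSwinnertonDyer.Rank1Residual.Additive.SubGss W 3 →
      W.analyticRank = 1 → ¬ W.HasSurjectiveModNGaloisRep 3 →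
      ∃ (N : ℕ) (_ : NeZero N) (K : Type) (_ : Field K) (_ : NumberField K)
        (Dt : Literature.NumberTheory.EllipticCurves.ModularForms.ModularParametrizationData W N)
        (H : Literature.NumberTheory.EllipticCurves.HeegnerDatum N (NumberField.discr K)) (ι : K →+* ℂ)
        (P : (W.baseChange K).toAffine.Point) (Wd : WeierstrassCurve ℚ) (_ : Wd.IsElliptic) (_ : Wd.IsGloballyMinimal)
        (Cd : WeierstrassCurve.VariableChange ℚ) (M : ℕ),
        W.conductorNorm ℤ = N ∧ Literature.NumberTheory.EllipticCurves.IsImaginaryQuadratic K ∧ Odd (NumberField.discr K) ∧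
        Literature.NumberTheory.EllipticCurves.SatisfiesHeegnerHypothesis N K ∧
        (W.quadraticTwist (NumberField.discr K : ℚ)).entireLFunction 1 ≠ 0 ∧
        WeierstrassCurve.Affine.Point.map ι.toRatAlgHom P = Literature.NumberTheory.EllipticCurves.ModularForms.heegnerPointComplex Dt H ∧
        Cd • W.quadraticTwist (NumberField.discr K : ℚ) = Wd ∧
        (2 * M : ℤ) ≤ padicValNat 3 W.tamagawaProduct + padicValNat 3 Wd.tamagawaProduct + 2 * padicValRat 3 (Dt.c : ℚ) ∧
        Summit.BirchSwinnertonDyer.Rank1Residual.X11b.Three.Koly.CertificateAt Dt H.β ι 3 M)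
    (hC0 : ∀ (W : WeierstrassCurve ℚ) [W.IsElliptic] [W.IsGloballyMinimal], ¬ W.HasCM →
      Literature.NumberTheory.EllipticCurves.Rank1Residual.Addv W 3 →
      Summit.BirchSwinnertonDyer.Rank1Residual.Additive.SubGss W 3 → W.analyticRank = 0 →
      ∃ (N : ℕ) (_ : NeZero N) (K : Type) (_ : Field K) (_ : NumberField K)
        (Dt : Literature.NumberTheory.EllipticCurves.ModularForms.ModularParametrizationData W N)
        (H : Literature.NumberTheory.EllipticCurves.HeegnerDatum N (NumberField.discr K)) (ι : K →+* ℂ)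
        (P : (W.baseChange K).toAffine.Point) (Wd : WeierstrassCurve ℚ) (_ : Wd.IsElliptic) (_ : Wd.IsGloballyMinimal)
        (Cd : WeierstrassCurve.VariableChange ℚ) (M : ℕ),
        W.conductorNorm ℤ = N ∧ Literature.NumberTheory.EllipticCurves.IsImaginaryQuadratic K ∧ Odd (NumberField.discr K) ∧
        Literature.NumberTheory.EllipticCurves.SatisfiesHeegnerHypothesis N K ∧
        (W.quadraticTwist (NumberField.discr K : ℚ)).analyticRank = 1 ∧
        WeierstrassCurve.Affine.Point.map ι.toRatAlgHom P =
          Literature.NumberTheory.EllipticCurves.ModularForms.heegnerPointComplex Dt H ∧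
        Cd • W.quadraticTwist (NumberField.discr K : ℚ) = Wd ∧
        (2 * M : ℤ) ≤ padicValNat 3 W.tamagawaProduct + padicValNat 3 Wd.tamagawaProduct + 2 * padicValRat 3 (Dt.c : ℚ) ∧
        Summit.BirchSwinnertonDyer.Rank1Residual.X11b.Three.Koly.CertificateAt Dt H.β ι 3 M)
    (hS2 : JetchevDivisibilityReadingS2) (hSig : LeafSigmaStarDivisibilityAtThreeOptimalOffRows)
    (hTU0ns : ∀ (W : WeierstrassCurve ℚ) [W.IsElliptic] [W.IsGloballyMinimal], ¬ W.HasCM →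
      Literature.NumberTheory.EllipticCurves.Rank1Residual.Addv W 3 →
      Summit.BirchSwinnertonDyer.Rank1Residual.Additive.SubGss W 3 → W.analyticRank = 0 →
      ¬ W.HasSurjectiveModNGaloisRep 3 →
      ∃ (K : Type) (_ : Field K) (_ : NumberField K) (W₂ W₂d : WeierstrassCurve ℚ) (_ : W₂.IsElliptic)
        (_ : W₂.IsGloballyMinimal) (_ : W₂d.IsElliptic) (_ : W₂d.IsGloballyMinimal),
        IsImaginaryQuadratic K ∧ Odd (NumberField.discr K) ∧ SatisfiesHeegnerHypothesis (W.conductorNorm ℤ) K ∧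
        (W.quadraticTwist (NumberField.discr K : ℚ)).entireLFunction 1 = 0 ∧
        deriv (W.quadraticTwist (NumberField.discr K : ℚ)).entireLFunction 1 ≠ 0 ∧
        IsIsogenous W W₂ ∧ (∃ C : VariableChange ℚ, C • W₂.quadraticTwist (NumberField.discr K : ℚ) = W₂d) ∧
        ∃ qd : ℚ, shaAn W₂d = (qd : ℂ) ∧ padicValRat 3 qd ≤ 0)
    (hTU1 : ∀ (W : WeierstrassCurve ℚ) [W.IsElliptic] [W.IsGloballyMinimal], ¬ W.HasCM →
      Literature.NumberTheory.EllipticCurves.Rank1Residual.Addv W 3 →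
      Summit.BirchSwinnertonDyer.Rank1Residual.Additive.SubGss W 3 → W.analyticRank = 1 →
      SchneiderFree.Upper.TwistUnitFieldAt W 3) :
    Summit.BirchSwinnertonDyer.WAllExclAddGssAtThree := by
  obtain ⟨⟨hGZ, hKo, -, hGZK, hmod, -, -, -, -, -⟩, hKatoT⟩ := id hpub
  have hL1 : Gss2LowerAtThreeRankOne :=
    gss2LowerAtThreeRankOne_of_pub_of_pairStatements_of_twistUnitZeroNonsplit hpub hpub0 hMN hC hC3 hS2 hSig hTU0ns
  have hU0 : LeafRankZeroUpperAtThree :=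
    leafRankZeroUpperAtThree_of_katoTam_of_pairStatements_of_twistUnitZeroNonsplit hKatoT hGZK hmod hpub0 hS2 hSig hTU0ns
  have hU1 : LeafRankOneUpperAtThree :=
    RamifiedPairUpperBound.leafRankOneUpperAtThree_of_pubManin_of_divisibilityReading_of_sigmaStar_of_twistUnit hpubU hS2 hSig hTU1
  have hL0 : Gss2LowerAtThreeRankZero :=
    gss2LowerAtThreeRankZero_of_structIrr_of_certificatesZero_of_leafRankOneUpper hGZ hKo hGZK hmod hMN hC0 hU1
  exact closes hP hL1 hU1 hL0 hU0

end Summit.BirchSwinnertonDyer.BirchSwinnertonDyer.Theorems.RamifiedPairLowerBound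

end
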